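import Literature.Analysis.FluidPDE.OseenDuhamelPairCalculus
import Literature.Analysis.FluidPDE.MildSolutionProofs
import HarnessLib

/-!
# Crux `FrequencyRigidity` (stmt-NavierStokesRegularity-2955), line `two-ended-pinning`,
# stub S3c `stub_smallConstantBootstrap` — the Leray/KNSS gap in the co-moving frame

Helper file (lands `--supports stmt-NavierStokesRegularity-2955`; theorems only) proving the registered stub
`stub_smallConstantBootstrap` of skeleton v6 of the line: if a field `u` and a drift `β` on `(−∞,0) × ℝ³`
obey `‖u(τ,y) − β(τ)‖ ≤ A/√(−τ)` with `8 C₀ A < 1` (`C₀ = oseenSliceConst ℝ³`) and the zero-drift Oseen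
integral identity holds in every co-moving frame `y ↦ y + ∫ₐ β` (the conclusion of stub S3b), then
`u(t, ·) ≡ β(t)` for every `t < 0`.

The proof is VERBATIM the bootstrap of `Theorems/ExtremalTypeIConstantSmallConstantLiouville.lean`
(`smallConstantLiouville_step/iterate/eq_zero`, KNSS 2009 §4 p. 8) with the class hypothesis `h.mild_eq`
replaced by the frame identity (hypothesis `hid`, the conclusion of stub S3b) at base point `a = 4t − 1`, restart time `s = 4t`: sup norms are blind to the
frame translation, the caloric term is bounded by `Aₙ/(2√(−t))` (`norm_heatExtension_le`) and the Duhamel term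
by `4C₀Aₙ²/√(−t)` (`norm_oseenDuhamel_le_const`, no measurability needed), so `Aₙ ↦ Aₙ(1/2 + 4C₀Aₙ)`
contracts with ratio `θ = 1/2 + 4C₀A < 1`.

## References

* G. Koch, N. Nadirashvili, G. Seregin, V. Šverák, *Liouville theorems for the Navier–Stokes equations and
  applications*, Acta Math. 203 (2009) 83–105 = arXiv:0709.3599, §4 p. 8 (the bilinear bound), §6.
  [KochNadirashviliSereginSverak2009]
-/

set_option linter.dupNamespace false

noncomputable section

namespace Summit.NavierStokesRegularity.NavierStokesRegularity.Theorems.FrequencyRigidity.TwoEndedPinning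

open Literature.Analysis Literature.Analysis.FluidPDE MeasureTheory Set Filter Topology Function

/-- **One bootstrap step in the co-moving frame.**  If `‖u(τ,y) − β(τ)‖ ≤ B/√(−τ)` for all `τ < 0`, `y`
(`0 ≤ B`) and the frame identity holds, then `‖u(t,x) − β(t)‖ ≤ B(1/2 + 4C₀B)/√(−t)`: restart at `s = 4t` in
the frame based at `a = 4t − 1`, at the frame point `y = x − ∫ₐᵗ β`; caloric term `≤ B/(2√(−t))`
(`norm_heatExtension_le`), Duhamel term `≤ 4C₀B²/√(−t)` (`norm_oseenDuhamel_le_const`, `√(−3t) ≤ 2√(−t)`).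
[cite: KochNadirashviliSereginSverak2009, §4 p. 8 (arXiv:0709.3599)] -/
theorem frameBootstrap_step {u : ℝ → (EuclideanSpace ℝ (Fin 3)) → (EuclideanSpace ℝ (Fin 3))} {β : ℝ → (EuclideanSpace ℝ (Fin 3))}
    (hid : ∀ a s t : ℝ, a < s → s < t → t < 0 → ∀ y : (EuclideanSpace ℝ (Fin 3)),
      u t (y + ∫ ρ in a..t, β ρ) - β t =
        UnboundedOperators.heatExtension (fun z => u s (z + ∫ ρ in a..s, β ρ) - β s) (t - s) y -
          oseenDuhamel 1 s (fun σ z => u σ (z + ∫ ρ in a..σ, β ρ) - β σ)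
            (fun σ z => u σ (z + ∫ ρ in a..σ, β ρ) - β σ) t y)
    {B : ℝ} (hB : 0 ≤ B) (hbound : ∀ τ : ℝ, τ < 0 → ∀ y : (EuclideanSpace ℝ (Fin 3)), ‖u τ y - β τ‖ ≤ B / Real.sqrt (-τ))
    {t : ℝ} (ht : t < 0) (x : (EuclideanSpace ℝ (Fin 3))) :
    ‖u t x - β t‖ ≤ B * (1 / 2 + 4 * oseenSliceConst (EuclideanSpace ℝ (Fin 3)) * B) / Real.sqrt (-t) := by
  set s : ℝ := 4 * t with hs
  set a : ℝ := 4 * t - 1 with ha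
  have has : a < s := by rw [ha, hs]; linarith
  have hst : s < t := by rw [hs]; linarith
  have hs0 : s < 0 := hst.trans ht
  have hsq_pos : 0 < Real.sqrt (-t) := Real.sqrt_pos.2 (by linarith)
  have hC₀ : 0 < oseenSliceConst (EuclideanSpace ℝ (Fin 3)) := oseenSliceConst_pos
  -- the co-moving, drift-subtracted field in the frame based at `a`
  set U : ℝ → (EuclideanSpace ℝ (Fin 3)) → (EuclideanSpace ℝ (Fin 3)) := fun σ z => u σ (z + ∫ ρ in a..σ, β ρ) - β σ with hU
  have hUb : ∀ σ : ℝ, σ < 0 → ∀ z : (EuclideanSpace ℝ (Fin 3)), ‖U σ z‖ ≤ B / Real.sqrt (-σ) := by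
    intro σ hσ z
    simpa only [hU] using hbound σ hσ (z + ∫ ρ in a..σ, β ρ)
  -- the frame point
  set y : (EuclideanSpace ℝ (Fin 3)) := x - ∫ ρ in a..t, β ρ with hy
  have hxy : x = y + ∫ ρ in a..t, β ρ := by rw [hy, sub_add_cancel]
  have key : u t x - β t =
      UnboundedOperators.heatExtension (U s) (t - s) y - oseenDuhamel 1 s U U t y := by
    rw [hxy]
    exact hid a s t has hst ht y
  -- the caloric term
  have hheat : ‖UnboundedOperators.heatExtension (U s) (t - s) y‖ ≤ B / (2 * Real.sqrt (-t)) := by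
    have hsup : ∀ z, ‖U s z‖ ≤ B / (2 * Real.sqrt (-t)) := by
      intro z
      have hz := hUb s hs0 z
      have hsqs : Real.sqrt (-s) = 2 * Real.sqrt (-t) := by
        rw [hs, show -(4 * t) = 2 ^ 2 * (-t) by ring, Real.sqrt_mul (by norm_num),
          Real.sqrt_sq (by norm_num : (0 : ℝ) ≤ 2)]
      rwa [hsqs] at hz
    exact UnboundedOperators.norm_heatExtension_le hsup (sub_pos.2 hst) y
  -- the Duhamel term
  have hslab : ∀ τ ∈ Ioo s t, ∀ z, ‖U τ z‖ ≤ B / Real.sqrt (-t) := by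
    intro τ hτ z
    refine (hUb τ (hτ.2.trans ht) z).trans ?_
    exact div_le_div_of_nonneg_left hB hsq_pos (Real.sqrt_le_sqrt (by linarith [hτ.2]))
  have hduh : ‖oseenDuhamel 1 s U U t y‖ ≤ 4 * oseenSliceConst (EuclideanSpace ℝ (Fin 3)) * B ^ 2 / Real.sqrt (-t) := by
    refine (norm_oseenDuhamel_le_const hst.le hslab hslab y).trans ?_
    have hts : Real.sqrt (t - s) ≤ 2 * Real.sqrt (-t) := by
      rw [hs, show t - 4 * t = 3 * (-t) by ring]
      calc Real.sqrt (3 * (-t)) ≤ Real.sqrt (2 ^ 2 * (-t)) :=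
            Real.sqrt_le_sqrt (by nlinarith)
        _ = 2 * Real.sqrt (-t) := by
            rw [Real.sqrt_mul (by norm_num), Real.sqrt_sq (by norm_num : (0 : ℝ) ≤ 2)]
    have hsq_sq : Real.sqrt (-t) ^ 2 = -t := Real.sq_sqrt (by linarith)
    have hprod : B / Real.sqrt (-t) * (B / Real.sqrt (-t)) = B ^ 2 / (-t) := by
      rw [div_mul_div_comm, ← pow_two, ← pow_two, hsq_sq]
    rw [hprod]
    have hnt : 0 < -t := by linarith
    calc oseenSliceConst (EuclideanSpace ℝ (Fin 3)) * (B ^ 2 / -t) * (2 * Real.sqrt (t - s))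
        ≤ oseenSliceConst (EuclideanSpace ℝ (Fin 3)) * (B ^ 2 / -t) * (2 * (2 * Real.sqrt (-t))) := by
          gcongr
      _ = 4 * oseenSliceConst (EuclideanSpace ℝ (Fin 3)) * B ^ 2 / Real.sqrt (-t) := by
          rw [show (4 : ℝ) * oseenSliceConst (EuclideanSpace ℝ (Fin 3)) * B ^ 2 / Real.sqrt (-t)
              = 4 * oseenSliceConst (EuclideanSpace ℝ (Fin 3)) * B ^ 2 * Real.sqrt (-t) / (Real.sqrt (-t) * Real.sqrt (-t))
              by rw [mul_div_mul_right _ _ hsq_pos.ne']]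
          rw [← pow_two, hsq_sq]
          ring
  -- assemble
  calc ‖u t x - β t‖
      = ‖UnboundedOperators.heatExtension (U s) (t - s) y - oseenDuhamel 1 s U U t y‖ := by rw [key]
    _ ≤ ‖UnboundedOperators.heatExtension (U s) (t - s) y‖ + ‖oseenDuhamel 1 s U U t y‖ :=
        norm_sub_le _ _
    _ ≤ B / (2 * Real.sqrt (-t)) + 4 * oseenSliceConst (EuclideanSpace ℝ (Fin 3)) * B ^ 2 / Real.sqrt (-t) :=
        add_le_add hheat hduh
    _ = B * (1 / 2 + 4 * oseenSliceConst (EuclideanSpace ℝ (Fin 3)) * B) / Real.sqrt (-t) := by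
        field_simp

/-- **The bootstrap, iterated.**  With `θ = 1/2 + 4C₀A` (`≤ 1` as soon as `8C₀A < 1`), the bound improves to
`‖u(t,x) − β(t)‖ ≤ Aθⁿ/√(−t)` for every `n`. [cite: KochNadirashviliSereginSverak2009, §4 p. 8 (arXiv:0709.3599)] -/
theorem frameBootstrap_iterate {u : ℝ → (EuclideanSpace ℝ (Fin 3)) → (EuclideanSpace ℝ (Fin 3))} {β : ℝ → (EuclideanSpace ℝ (Fin 3))}
    (hid : ∀ a s t : ℝ, a < s → s < t → t < 0 → ∀ y : (EuclideanSpace ℝ (Fin 3)),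
      u t (y + ∫ ρ in a..t, β ρ) - β t =
        UnboundedOperators.heatExtension (fun z => u s (z + ∫ ρ in a..s, β ρ) - β s) (t - s) y -
          oseenDuhamel 1 s (fun σ z => u σ (z + ∫ ρ in a..σ, β ρ) - β σ)
            (fun σ z => u σ (z + ∫ ρ in a..σ, β ρ) - β σ) t y)
    {A : ℝ} (hA : 0 ≤ A) (hsmall : 8 * oseenSliceConst (EuclideanSpace ℝ (Fin 3)) * A < 1)
    (hbound : ∀ τ : ℝ, τ < 0 → ∀ y : (EuclideanSpace ℝ (Fin 3)), ‖u τ y - β τ‖ ≤ A / Real.sqrt (-τ)) (n : ℕ) :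
    ∀ t : ℝ, t < 0 → ∀ x : (EuclideanSpace ℝ (Fin 3)),
      ‖u t x - β t‖ ≤ A * (1 / 2 + 4 * oseenSliceConst (EuclideanSpace ℝ (Fin 3)) * A) ^ n / Real.sqrt (-t) := by
  have hC₀ : 0 < oseenSliceConst (EuclideanSpace ℝ (Fin 3)) := oseenSliceConst_pos
  set θ : ℝ := 1 / 2 + 4 * oseenSliceConst (EuclideanSpace ℝ (Fin 3)) * A with hθ
  have hθ0 : 0 ≤ θ := by rw [hθ]; positivity
  have hθ1 : θ ≤ 1 := by rw [hθ]; linarith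
  induction n with
  | zero =>
      intro t ht x
      simpa using hbound t ht x
  | succ n ih =>
      intro t ht x
      have hB : 0 ≤ A * θ ^ n := mul_nonneg hA (pow_nonneg hθ0 n)
      have hBA : A * θ ^ n ≤ A := mul_le_of_le_one_right hA (pow_le_one₀ hθ0 hθ1)
      have hstep := frameBootstrap_step hid hB ih ht x
      have hsq_pos : 0 < Real.sqrt (-t) := Real.sqrt_pos.2 (by linarith)
      refine hstep.trans (div_le_div_of_nonneg_right ?_ hsq_pos.le)
      calc A * θ ^ n * (1 / 2 + 4 * oseenSliceConst (EuclideanSpace ℝ (Fin 3)) * (A * θ ^ n))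
          ≤ A * θ ^ n * θ := by
            refine mul_le_mul_of_nonneg_left ?_ hB
            rw [hθ]
            gcongr
        _ = A * θ ^ (n + 1) := by ring

/-- **The gap**: under `8C₀A < 1` the iterated bound tends to `0`, so `u(t, x) = β(t)`.
[cite: KochNadirashviliSereginSverak2009, §4 p. 8 and §6 (arXiv:0709.3599)] -/
theorem frameBootstrap_eq {u : ℝ → (EuclideanSpace ℝ (Fin 3)) → (EuclideanSpace ℝ (Fin 3))} {β : ℝ → (EuclideanSpace ℝ (Fin 3))}
    (hid : ∀ a s t : ℝ, a < s → s < t → t < 0 → ∀ y : (EuclideanSpace ℝ (Fin 3)),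
      u t (y + ∫ ρ in a..t, β ρ) - β t =
        UnboundedOperators.heatExtension (fun z => u s (z + ∫ ρ in a..s, β ρ) - β s) (t - s) y -
          oseenDuhamel 1 s (fun σ z => u σ (z + ∫ ρ in a..σ, β ρ) - β σ)
            (fun σ z => u σ (z + ∫ ρ in a..σ, β ρ) - β σ) t y)
    {A : ℝ} (hA : 0 ≤ A) (hsmall : 8 * oseenSliceConst (EuclideanSpace ℝ (Fin 3)) * A < 1)
    (hbound : ∀ τ : ℝ, τ < 0 → ∀ y : (EuclideanSpace ℝ (Fin 3)), ‖u τ y - β τ‖ ≤ A / Real.sqrt (-τ))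
    {t : ℝ} (ht : t < 0) (x : (EuclideanSpace ℝ (Fin 3))) : u t x = β t := by
  have hC₀ : 0 < oseenSliceConst (EuclideanSpace ℝ (Fin 3)) := oseenSliceConst_pos
  set θ : ℝ := 1 / 2 + 4 * oseenSliceConst (EuclideanSpace ℝ (Fin 3)) * A with hθ
  have hθ0 : 0 ≤ θ := by rw [hθ]; positivity
  have hθ1 : θ < 1 := by rw [hθ]; linarith
  have hlim : Tendsto (fun n : ℕ => A * θ ^ n / Real.sqrt (-t)) atTop (𝓝 0) := by
    have := ((tendsto_pow_atTop_nhds_zero_of_lt_one hθ0 hθ1).const_mul A).div_const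
      (Real.sqrt (-t))
    simpa using this
  have hle : ‖u t x - β t‖ ≤ 0 :=
    ge_of_tendsto' hlim fun n => frameBootstrap_iterate hid hA hsmall hbound n t ht x
  exact sub_eq_zero.1 (norm_le_zero_iff.1 hle)

/-- **Stub S3c `stub_smallConstantBootstrap` of skeleton v6 of line `two-ended-pinning`** (registered
signature verbatim): the Leray/KNSS gap in the co-moving frame — `8C₀A < 1`, `‖u − β‖ ≤ A/√(−t)` and the
zero-drift Oseen identity in every co-moving frame force `u(t, ·) ≡ β(t)`. [cite: KochNadirashviliSereginSverak2009, §4 p. 8 and §6 (arXiv:0709.3599)] -/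
theorem stub_smallConstantBootstrap :
    ∀ (A : ℝ) (u : ℝ → EuclideanSpace ℝ (Fin 3) → EuclideanSpace ℝ (Fin 3)) (β : ℝ → EuclideanSpace ℝ (Fin 3)),
      0 ≤ A → 8 * Literature.Analysis.FluidPDE.oseenSliceConst (EuclideanSpace ℝ (Fin 3)) * A < 1 →
      (∀ τ : ℝ, τ < 0 → ∀ y : EuclideanSpace ℝ (Fin 3), ‖u τ y - β τ‖ ≤ A / Real.sqrt (-τ)) →
      (∀ a s t : ℝ, a < s → s < t → t < 0 → ∀ y : EuclideanSpace ℝ (Fin 3),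
        u t (y + ∫ ρ in a..t, β ρ) - β t =
          Literature.Analysis.UnboundedOperators.heatExtension
              (fun z => u s (z + ∫ ρ in a..s, β ρ) - β s) (t - s) y -
            Literature.Analysis.FluidPDE.oseenDuhamel 1 s
              (fun σ z => u σ (z + ∫ ρ in a..σ, β ρ) - β σ)
              (fun σ z => u σ (z + ∫ ρ in a..σ, β ρ) - β σ) t y) →
      ∀ t : ℝ, t < 0 → ∀ y : EuclideanSpace ℝ (Fin 3), u t y = β t := by
  intro A u β hA hsmall hbound hid t ht y
  exact frameBootstrap_eq hid hA hsmall hbound ht y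

end Summit.NavierStokesRegularity.NavierStokesRegularity.Theorems.FrequencyRigidity.TwoEndedPinning

end
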